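import Literature.Topology.FourManifolds.TrisectionsTopFaceZone
import Mathlib.Analysis.SpecialFunctions.Trigonometric.InverseDeriv
import HarnessLib

/-!
# The Morse function of the top face at the rim points: index `0` and `1`

Topic `Literature/Topology/FourManifolds`; step G (part c-3) of a Morse-theoretic construction
of Gay–Kirby's trisection for the fact seat
`provefact-Literature.Topology.FourManifolds.exists_isBalancedGKTrisection` (Gay–Kirby 2016,
Thm. 4 via §4, Lemma 14).  Everything in this file is **proved**; the definitions (model
functions, the rim parametrisations) are explicit.

At the two rim points `{x = 0, y = (±√β₀, 0)}` of the zone part `{B_j = β₀}` of the zero set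
`N` of the gap function (`TrisectionsTopFaceZone.lean`), the top-face function in the
parametrisation `(u₀, u₁, θ) ↦ chart⁻¹(chart c_j + (u₀, u₁, ±√β₀ cos θ, √β₀ sin θ))` is
`c₀(1 - ερ₀u₀² + (κβ₀/η)(u₀² + u₁²)) ± ε₄ χ₀ √β₀ cos θ` near the origin (`ρ`, `χ_b` constant
near `0`): a critical point with diagonal Hessian
`diag(2c₀(κβ₀/η - ερ₀), 2c₀κβ₀/η, ∓ε₄χ₀√β₀)`, nondegenerate of index `1` at the top point and
`0` at the bottom point when `κβ₀/η > ερ₀` (`morseData_quadCos`, the signature lemmas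
`nondegenerate_and_sigNeg_eq_zero_of_diag3`, `nondegenerate_and_sigNeg_eq_one_of_diag3`).

## References

* D. Gay, R. Kirby, *Trisecting 4-manifolds*, Geom. Topol. 20 (2016), §4, Lemma 14. [GayKirby2016]
* J. Milnor, *Morse theory* (1963), §2. [Milnor1963]
-/

open scoped Manifold ContDiff Topology
open Set Function Filter

noncomputable section

universe u

namespace Literature.Topology.FourManifolds

/-- Local notation: `𝔼 n` is the model Euclidean space `EuclideanSpace ℝ (Fin n)`. -/
local notation "𝔼 " n:arg => EuclideanSpace ℝ (Fin n)

namespace RimModel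

/-! ### Signatures of diagonal forms on `ℝ³` -/

/-- The coordinate functionals on `ℝ³`. [folklore] -/
abbrev d3 (i : Fin 3) : 𝔼 3 →L[ℝ] ℝ := EuclideanSpace.proj i

/-- `d3 i u = u i`. [folklore] -/
@[simp] theorem d3_apply (i : Fin 3) (u : 𝔼 3) : d3 i u = u i := rfl

/-- The basis vector `eᵢ` of `ℝ³`. [folklore] -/
def E3 (i : Fin 3) : 𝔼 3 := WithLp.toLp 2 (Pi.single i 1)

/-- The entries of `eᵢ`. [folklore] -/
@[simp] theorem E3_apply (i j : Fin 3) : E3 i j = if j = i then 1 else 0 := by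
  simp [E3]

variable {B : LinearMap.BilinForm ℝ (𝔼 3)} {p q r : ℝ}

/-- A diagonal form is determined on vectors: nondegeneracy from nonzero entries. [folklore] -/
theorem nondegenerate_of_diag3 (hp : p ≠ 0) (hq : q ≠ 0) (hr : r ≠ 0)
    (hB : ∀ v w, B v w = p * (v 0 * w 0) + q * (v 1 * w 1) + r * (v 2 * w 2)) : B.Nondegenerate := by
  have hsep : ∀ x : 𝔼 3, (∀ y, B x y = 0) → x = 0 := by
    intro x hx
    have h0 := hx (E3 0)
    have h1 := hx (E3 1)
    have h2 := hx (E3 2)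
    simp only [hB, E3_apply] at h0 h1 h2
    simp only [Fin.isValue, ↓reduceIte, mul_one, Fin.reduceEq, mul_zero, add_zero, zero_add,
      mul_eq_zero, hp, hq, hr, false_or] at h0 h1 h2
    ext i
    fin_cases i
    · simpa using h0
    · simpa using h1
    · simpa using h2
  have hsymm : ∀ x y, B x y = B y x := fun x y => by rw [hB, hB]; ring
  exact ⟨fun x hx => hsep x (fun y => by simpa using hx y), fun x hx => hsep x (fun y => by rw [hsymm]; simpa using hx y)⟩

/-- **Index `0`**: a diagonal form with positive entries is nondegenerate of negative index of
inertia `0`. [cite: Milnor1963, §2] -/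
theorem nondegenerate_and_sigNeg_eq_zero_of_diag3 (hp : 0 < p) (hq : 0 < q) (hr : 0 < r)
    (hB : ∀ v w, B v w = p * (v 0 * w 0) + q * (v 1 * w 1) + r * (v 2 * w 2)) :
    B.Nondegenerate ∧ sigNeg B.toQuadraticMap = 0 := by
  refine ⟨nondegenerate_of_diag3 hp.ne' hq.ne' hr.ne' hB, LinearMap.BilinForm.sigNeg_eq_zero_of_posDef ?_⟩
  intro x hx
  have hne : x 0 ≠ 0 ∨ x 1 ≠ 0 ∨ x 2 ≠ 0 := by
    by_contra h
    simp only [not_or, not_not] at h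
    apply hx
    ext i
    fin_cases i
    · simpa using h.1
    · simpa using h.2.1
    · simpa using h.2.2
  simp only [LinearMap.BilinMap.toQuadraticMap_apply, hB]
  rcases hne with h | h | h
  · have := sq_pos_of_ne_zero h
    nlinarith [mul_nonneg hq.le (mul_self_nonneg (x 1)), mul_nonneg hr.le (mul_self_nonneg (x 2))]
  · have := sq_pos_of_ne_zero h
    nlinarith [mul_nonneg hp.le (mul_self_nonneg (x 0)), mul_nonneg hr.le (mul_self_nonneg (x 2))]
  · have := sq_pos_of_ne_zero h
    nlinarith [mul_nonneg hp.le (mul_self_nonneg (x 0)), mul_nonneg hq.le (mul_self_nonneg (x 1))]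

/-- **Index `1`**: a diagonal form `p v₀w₀ + q v₁w₁ - r v₂w₂` with `p, q, r > 0` is
nondegenerate of negative index of inertia `1`. [cite: Milnor1963, §2] -/
theorem nondegenerate_and_sigNeg_eq_one_of_diag3 (hp : 0 < p) (hq : 0 < q) (hr : 0 < r)
    (hB : ∀ v w, B v w = p * (v 0 * w 0) + q * (v 1 * w 1) + -r * (v 2 * w 2)) :
    B.Nondegenerate ∧ sigNeg B.toQuadraticMap = 1 := by
  refine ⟨nondegenerate_of_diag3 hp.ne' hq.ne' (neg_ne_zero.2 hr.ne') hB, ?_⟩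
  -- project to the `v₂`-line
  let π : 𝔼 3 →ₗ[ℝ] ℝ := (d3 2 : 𝔼 3 →L[ℝ] ℝ).toLinearMap
  let ι : ℝ →ₗ[ℝ] 𝔼 3 := LinearMap.toSpanSingleton ℝ (𝔼 3) (E3 2)
  let Q' : QuadraticForm ℝ ℝ :=
    LinearMap.BilinMap.toQuadraticMap ((-r) • (LinearMap.mul ℝ ℝ : ℝ →ₗ[ℝ] ℝ →ₗ[ℝ] ℝ))
  have hQ' : ∀ t : ℝ, Q' t = -r * (t * t) := fun t => by simp [Q']
  have hQ : ∀ x : 𝔼 3, B.toQuadraticMap x = p * (x 0 * x 0) + q * (x 1 * x 1) + -r * (x 2 * x 2) :=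
    fun x => by simp [LinearMap.BilinMap.toQuadraticMap_apply, hB]
  have key : sigNeg B.toQuadraticMap = sigNeg Q' := by
    refine sigNeg_eq_of_proj _ Q' π ι (fun x => ?_) (fun x hx => ?_) (fun t => ?_) (fun t => ?_)
    · rw [hQ, hQ']
      simp only [π, ContinuousLinearMap.coe_coe, d3_apply]
      nlinarith [mul_nonneg hp.le (mul_self_nonneg (x 0)), mul_nonneg hq.le (mul_self_nonneg (x 1))]
    · simp only [π, ContinuousLinearMap.coe_coe, d3_apply] at hx
      rw [hQ, hx]
      nlinarith [mul_nonneg hp.le (mul_self_nonneg (x 0)), mul_nonneg hq.le (mul_self_nonneg (x 1))]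
    · rw [hQ, hQ']
      simp [ι]
    · simp [π, ι]
  rw [key]
  apply le_antisymm
  · calc sigNeg Q' = sigPos (-Q') := by rw [sigPos_neg]
      _ ≤ Module.finrank ℝ ℝ := sigPos_le_finrank _
      _ = 1 := Module.finrank_self ℝ
  · have hneg : ((-Q').restrict ⊤).PosDef := by
      intro t ht
      have ht' : (t : ℝ) ≠ 0 := fun h => ht (Subtype.ext h)
      simp only [QuadraticMap.restrict_apply, QuadraticMap.neg_apply, hQ']
      nlinarith [mul_pos hr (mul_self_pos.2 ht')]
    have := le_sigNeg_of_negDef Q' hneg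
    rw [finrank_top, Module.finrank_self] at this
    exact this

/-! ### The model function `C + a u₀² + b u₁² + K cos u₂` -/

/-- The model function of the rim parametrisation near the origin. [folklore] -/
def quadCos (C a b K : ℝ) (u : 𝔼 3) : ℝ := C + a * u 0 ^ 2 + b * u 1 ^ 2 + K * Real.cos (u 2)

/-- The derivative of the model function. [folklore] -/
theorem hasFDerivAt_quadCos (C a b K : ℝ) (u : 𝔼 3) :
    HasFDerivAt (quadCos C a b K) ((a * (2 * u 0)) • (d3 0 : 𝔼 3 →L[ℝ] ℝ) + (b * (2 * u 1)) • (d3 1 : 𝔼 3 →L[ℝ] ℝ) +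
      (K * -Real.sin (u 2)) • (d3 2 : 𝔼 3 →L[ℝ] ℝ)) u := by
  have h0 : HasFDerivAt (fun u : 𝔼 3 => (d3 0 : 𝔼 3 →L[ℝ] ℝ) u ^ 2) ((2 * u 0) • (d3 0 : 𝔼 3 →L[ℝ] ℝ)) u := by
    have := ((d3 0 : 𝔼 3 →L[ℝ] ℝ).hasFDerivAt (x := u)).pow 2
    refine this.congr_fderiv ?_
    ext v; simp
  have h1 : HasFDerivAt (fun u : 𝔼 3 => (d3 1 : 𝔼 3 →L[ℝ] ℝ) u ^ 2) ((2 * u 1) • (d3 1 : 𝔼 3 →L[ℝ] ℝ)) u := by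
    have := ((d3 1 : 𝔼 3 →L[ℝ] ℝ).hasFDerivAt (x := u)).pow 2
    refine this.congr_fderiv ?_
    ext v; simp
  have h2 : HasFDerivAt (fun u : 𝔼 3 => Real.cos ((d3 2 : 𝔼 3 →L[ℝ] ℝ) u)) ((-Real.sin (u 2)) • (d3 2 : 𝔼 3 →L[ℝ] ℝ)) u := by
    exact (Real.hasDerivAt_cos (u 2)).comp_hasFDerivAt u ((d3 2 : 𝔼 3 →L[ℝ] ℝ).hasFDerivAt (x := u))
  have h := (((h0.const_mul a).add (h1.const_mul b)).add (h2.const_mul K)).const_add C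
  have hfun : quadCos C a b K = fun u => C + (a * (d3 0 : 𝔼 3 →L[ℝ] ℝ) u ^ 2 + b * (d3 1 : 𝔼 3 →L[ℝ] ℝ) u ^ 2 +
      K * Real.cos ((d3 2 : 𝔼 3 →L[ℝ] ℝ) u)) := by
    funext u; simp [quadCos]; ring
  rw [hfun]
  refine h.congr_fderiv ?_
  ext v
  simp only [add_apply, smul_apply, d3_apply, smul_eq_mul]
  ring

/-- The derivative as a function. [folklore] -/
theorem fderiv_quadCos (C a b K : ℝ) : fderiv ℝ (quadCos C a b K) = fun u =>
    (a * (2 * u 0)) • (d3 0 : 𝔼 3 →L[ℝ] ℝ) + (b * (2 * u 1)) • (d3 1 : 𝔼 3 →L[ℝ] ℝ) +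
      (K * -Real.sin (u 2)) • (d3 2 : 𝔼 3 →L[ℝ] ℝ) :=
  funext fun u => (hasFDerivAt_quadCos C a b K u).fderiv

/-- The origin is a critical point of the model function. [folklore] -/
theorem fderiv_quadCos_zero (C a b K : ℝ) : fderiv ℝ (quadCos C a b K) 0 = 0 := by
  rw [fderiv_quadCos]; simp

/-- **The second derivative of the model function at the origin**:
`diag(2a, 2b, -K)`. [cite: Milnor1963, §2] -/
theorem hasFDerivAt_fderiv_quadCos_zero (C a b K : ℝ) :
    HasFDerivAt (fderiv ℝ (quadCos C a b K))
      (((2 * a) • (d3 0 : 𝔼 3 →L[ℝ] ℝ)).smulRight (d3 0 : 𝔼 3 →L[ℝ] ℝ) +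
        ((2 * b) • (d3 1 : 𝔼 3 →L[ℝ] ℝ)).smulRight (d3 1 : 𝔼 3 →L[ℝ] ℝ) +
        ((-K) • (d3 2 : 𝔼 3 →L[ℝ] ℝ)).smulRight (d3 2 : 𝔼 3 →L[ℝ] ℝ)) 0 := by
  rw [fderiv_quadCos]
  have hα : HasFDerivAt (fun u : 𝔼 3 => a * (2 * u 0)) ((2 * a) • (d3 0 : 𝔼 3 →L[ℝ] ℝ)) 0 := by
    have := (((d3 0 : 𝔼 3 →L[ℝ] ℝ).hasFDerivAt (x := 0)).const_mul (2 : ℝ)).const_mul a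
    refine this.congr_fderiv ?_
    ext v; simp; ring
  have hβ : HasFDerivAt (fun u : 𝔼 3 => b * (2 * u 1)) ((2 * b) • (d3 1 : 𝔼 3 →L[ℝ] ℝ)) 0 := by
    have := (((d3 1 : 𝔼 3 →L[ℝ] ℝ).hasFDerivAt (x := 0)).const_mul (2 : ℝ)).const_mul b
    refine this.congr_fderiv ?_
    ext v; simp; ring
  have hγ : HasFDerivAt (fun u : 𝔼 3 => K * -Real.sin (u 2)) ((-K) • (d3 2 : 𝔼 3 →L[ℝ] ℝ)) 0 := by
    have h2 : HasFDerivAt (fun u : 𝔼 3 => Real.sin ((d3 2 : 𝔼 3 →L[ℝ] ℝ) u)) ((Real.cos ((0 : 𝔼 3) 2)) • (d3 2 : 𝔼 3 →L[ℝ] ℝ)) 0 := by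
      have := (Real.hasDerivAt_sin ((0 : 𝔼 3) 2)).comp_hasFDerivAt (0 : 𝔼 3) ((d3 2 : 𝔼 3 →L[ℝ] ℝ).hasFDerivAt (x := 0))
      simpa [Function.comp_def] using this
    have := (h2.neg).const_mul K
    refine this.congr_fderiv ?_
    ext v; simp
  exact ((hα.smul_const (d3 0 : 𝔼 3 →L[ℝ] ℝ)).add (hβ.smul_const (d3 1 : 𝔼 3 →L[ℝ] ℝ))).add
    (hγ.smul_const (d3 2 : 𝔼 3 →L[ℝ] ℝ))

/-- **The Hessian of the model function at the origin**: `2a v₀w₀ + 2b v₁w₁ - K v₂w₂`. [cite: Milnor1963, §2] -/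
theorem fderiv_fderiv_quadCos_zero_apply (C a b K : ℝ) (v w : 𝔼 3) :
    fderiv ℝ (fderiv ℝ (quadCos C a b K)) 0 v w = 2 * a * (v 0 * w 0) + 2 * b * (v 1 * w 1) + -K * (v 2 * w 2) := by
  rw [(hasFDerivAt_fderiv_quadCos_zero C a b K).fderiv]
  simp only [add_apply, ContinuousLinearMap.smulRight_apply, smul_apply, d3_apply, smul_eq_mul]
  ring

/-- The model function is smooth. [folklore] -/
theorem contDiff_quadCos (C a b K : ℝ) : ContDiff ℝ ∞ (quadCos C a b K) := by
  unfold quadCos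
  exact ((contDiff_const.add (contDiff_const.mul ((d3 0 : 𝔼 3 →L[ℝ] ℝ).contDiff.pow 2))).add
    (contDiff_const.mul ((d3 1 : 𝔼 3 →L[ℝ] ℝ).contDiff.pow 2))).add
    (contDiff_const.mul (Real.contDiff_cos.comp (d3 2 : 𝔼 3 →L[ℝ] ℝ).contDiff))

/-- **Morse data of the model function at the origin**: for `a, b > 0` and `K ≠ 0`, the origin
is a nondegenerate critical point of index `1` if `K > 0` and `0` if `K < 0`. [cite: Milnor1963, §2] -/
theorem morseData_quadCos {C a b K : ℝ} (ha : 0 < a) (hb : 0 < b) (hK : K ≠ 0) :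
    IsMCriticalPt (𝓡 3) (quadCos C a b K) 0 ∧ (mhessian (𝓡 3) (quadCos C a b K) 0).Nondegenerate ∧
      morseIndex (𝓡 3) (quadCos C a b K) 0 = (if 0 < K then 1 else 0) := by
  have hcrit : IsMCriticalPt (𝓡 3) (quadCos C a b K) 0 := by
    rw [MorseBirth.isMCriticalPt_iff_fderiv, fderiv_quadCos_zero]
  have hH : ∀ v w, mhessian (𝓡 3) (quadCos C a b K) 0 v w =
      2 * a * (v 0 * w 0) + 2 * b * (v 1 * w 1) + -K * (v 2 * w 2) := fun v w => by
    rw [MorseBirth.mhessian_model_apply, fderiv_fderiv_quadCos_zero_apply]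
  refine ⟨hcrit, ?_⟩
  by_cases hK0 : 0 < K
  · obtain ⟨hnd, hsig⟩ := nondegenerate_and_sigNeg_eq_one_of_diag3 (B := mhessian (𝓡 3) (quadCos C a b K) 0)
      (p := 2 * a) (q := 2 * b) (r := K) (by linarith) (by linarith) hK0 hH
    refine ⟨hnd, ?_⟩
    rw [if_pos hK0]
    unfold morseIndex
    exact hsig
  · have hKneg : 0 < -K := by push Not at hK0; exact lt_of_le_of_ne (neg_nonneg.2 hK0) (Ne.symm (neg_ne_zero.2 hK))
    obtain ⟨hnd, hsig⟩ := nondegenerate_and_sigNeg_eq_zero_of_diag3 (B := mhessian (𝓡 3) (quadCos C a b K) 0)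
      (p := 2 * a) (q := 2 * b) (r := -K) (by linarith) (by linarith) hKneg hH
    refine ⟨hnd, ?_⟩
    rw [if_neg hK0]
    unfold morseIndex
    exact hsig

end RimModel

/-! ### The rim parametrisations -/

variable {X : Type u} [TopologicalSpace X] [T2Space X] [CompactSpace X] [ChartedSpace (𝔼 4) X]
  [IsManifold (𝓡 4) ∞ X]

namespace HandleBoxes

open RimModel

variable {f : X → ℝ} {ξ : Π x : X, TangentSpace (𝓡 4) x} {a η : ℝ} {ι : Type} [Fintype ι]
  (H : HandleBoxes f ξ a η ι)
  {hξ : ContMDiff (𝓡 4) (𝓡 4).tangent ∞ fun x => (⟨x, ξ x⟩ : TangentBundle (𝓡 4) X)}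
  {h : IsRegularLevel (𝓡 4) f a} {φ : RegularLevel h → ℝ} {h₂ TP χlo χhi ρ χb : ℝ → ℝ}
  {Spl Sbot Smin Psw c₀ ε κ aR ε₄ β₀ P₁ : ℝ}

/-- The coordinate vector `(b₀, b₁, b₂)` of `ℝ³`. [folklore] -/
def vec3 (b₀ b₁ b₂ : ℝ) : 𝔼 3 := WithLp.toLp 2 ![b₀, b₁, b₂]

omit [T2Space X] [CompactSpace X] [IsManifold (𝓡 4) ∞ X] [Fintype ι] in
/-- The entry `b₀` of `vec3 b₀ b₁ b₂`. [folklore] -/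
@[simp] theorem vec3_apply_zero (b₀ b₁ b₂ : ℝ) : vec3 b₀ b₁ b₂ 0 = b₀ := rfl
omit [T2Space X] [CompactSpace X] [IsManifold (𝓡 4) ∞ X] [Fintype ι] in
/-- The entry `b₁` of `vec3 b₀ b₁ b₂`. [folklore] -/
@[simp] theorem vec3_apply_one (b₀ b₁ b₂ : ℝ) : vec3 b₀ b₁ b₂ 1 = b₁ := rfl
omit [T2Space X] [CompactSpace X] [IsManifold (𝓡 4) ∞ X] [Fintype ι] in
/-- The entry `b₂` of `vec3 b₀ b₁ b₂`. [folklore] -/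
@[simp] theorem vec3_apply_two (b₀ b₁ b₂ : ℝ) : vec3 b₀ b₁ b₂ 2 = b₂ := rfl

omit [T2Space X] [CompactSpace X] [IsManifold (𝓡 4) ∞ X] [Fintype ι] in
/-- `vec3` of the entries of a vector is the vector. [folklore] -/
theorem vec3_eta (u : 𝔼 3) : vec3 (u 0) (u 1) (u 2) = u := by
  ext i; fin_cases i <;> rfl

omit [T2Space X] [CompactSpace X] [IsManifold (𝓡 4) ∞ X] [Fintype ι] in
/-- `vec3` as a combination of the basis vectors. [folklore] -/
theorem vec3_eq_sum (b₀ b₁ b₂ : ℝ) : vec3 b₀ b₁ b₂ = b₀ • E3 0 + b₁ • E3 1 + b₂ • E3 2 := by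
  ext i; fin_cases i <;> simp [vec3]

/-- **The rim parametrisation** `u ↦ chart⁻¹(chart c_j + (u₀, u₁, σ√β₀ cos u₂, √β₀ sin u₂))`
(`σ = ±1`). [cite: GayKirby2016, §4, Lemma 14] -/
def rimMap (σ β₀ : ℝ) (j : ι) (u : 𝔼 3) : X :=
  (H.box j).chart.symm ((H.box j).chart (H.cpt j) +
    vec4 (u 0) (u 1) (σ * Real.sqrt β₀ * Real.cos (u 2)) (Real.sqrt β₀ * Real.sin (u 2)))

/-- The rim coordinates `z ↦ (y₀, y₁, arcsin(y₃/√β₀))`. [folklore] -/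
def rimCoord (β₀ : ℝ) (j : ι) (z : X) : 𝔼 3 :=
  vec3 ((H.box j).coord z 0) ((H.box j).coord z 1) (Real.arcsin ((H.box j).coord z 3 / Real.sqrt β₀))

omit [T2Space X] [CompactSpace X] [IsManifold (𝓡 4) ∞ X] [Fintype ι] in
/-- The coordinate vector of the rim map has norm `< 3ε` when `u₀² + u₁² < a_R < η`, `β₀ < η`, `σ² = 1`. [folklore] -/
theorem norm_rimVec_lt {σ : ℝ} (hσ : σ ^ 2 = 1) (hβ₀ : 0 ≤ β₀) (hβ₀η : β₀ < η) (haR : aR < η) (j : ι) {u : 𝔼 3}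
    (hu : u 0 ^ 2 + u 1 ^ 2 < aR) :
    ‖vec4 (u 0) (u 1) (σ * Real.sqrt β₀ * Real.cos (u 2)) (Real.sqrt β₀ * Real.sin (u 2))‖ < 3 * (H.box j).ε := by
  apply H.norm_lt_of_sq_lt j
  simp only [vec4_apply_zero, vec4_apply_one, vec4_apply_two, vec4_apply_three]
  have hs := Real.sin_sq_add_cos_sq (u 2)
  have hb : (σ * Real.sqrt β₀ * Real.cos (u 2)) ^ 2 + (Real.sqrt β₀ * Real.sin (u 2)) ^ 2 = β₀ := by
    have h1 : Real.sqrt β₀ ^ 2 = β₀ := Real.sq_sqrt hβ₀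
    calc (σ * Real.sqrt β₀ * Real.cos (u 2)) ^ 2 + (Real.sqrt β₀ * Real.sin (u 2)) ^ 2
        = σ ^ 2 * Real.sqrt β₀ ^ 2 * Real.cos (u 2) ^ 2 + Real.sqrt β₀ ^ 2 * Real.sin (u 2) ^ 2 := by ring
      _ = β₀ * (Real.sin (u 2) ^ 2 + Real.cos (u 2) ^ 2) := by rw [hσ, h1]; ring
      _ = β₀ := by rw [hs, mul_one]
  have := H.eta_pos
  nlinarith [hb]

omit [T2Space X] [CompactSpace X] [IsManifold (𝓡 4) ∞ X] [Fintype ι] in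
/-- **The rim map near `u` with `u₀² + u₁² < a_R`**: it lands in `source_j` with the said
coordinates, `A_j = u₀² + u₁²`, `B_j = β₀`. [folklore] -/
theorem rimMap_props {σ : ℝ} (hσ : σ ^ 2 = 1) (hβ₀ : 0 ≤ β₀) (hβ₀η : β₀ < η) (haR : aR < η) (j : ι) {u : 𝔼 3}
    (hu : u 0 ^ 2 + u 1 ^ 2 < aR) :
    H.rimMap σ β₀ j u ∈ (H.box j).chart.source ∧
      (H.box j).coord (H.rimMap σ β₀ j u) = vec4 (u 0) (u 1) (σ * Real.sqrt β₀ * Real.cos (u 2)) (Real.sqrt β₀ * Real.sin (u 2)) ∧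
      H.A j (H.rimMap σ β₀ j u) = u 0 ^ 2 + u 1 ^ 2 ∧ H.B j (H.rimMap σ β₀ j u) = β₀ := by
  have hvn := H.norm_rimVec_lt hσ hβ₀ hβ₀η haR j hu
  have hsrc : H.rimMap σ β₀ j u ∈ (H.box j).chart.source := (H.box j).chart_symm_add_mem_source hvn.le
  have hcoord : (H.box j).coord (H.rimMap σ β₀ j u) = _ := (H.box j).coord_chart_symm_add hvn.le
  refine ⟨hsrc, hcoord, ?_, ?_⟩
  · rw [H.A_eq_coord, hcoord]; simp
  · rw [H.B_eq_coord, hcoord]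
    simp only [vec4_apply_two, vec4_apply_three]
    have h1 : Real.sqrt β₀ ^ 2 = β₀ := Real.sq_sqrt hβ₀
    calc (σ * Real.sqrt β₀ * Real.cos (u 2)) ^ 2 + (Real.sqrt β₀ * Real.sin (u 2)) ^ 2
        = σ ^ 2 * Real.sqrt β₀ ^ 2 * Real.cos (u 2) ^ 2 + Real.sqrt β₀ ^ 2 * Real.sin (u 2) ^ 2 := by ring
      _ = β₀ * (Real.sin (u 2) ^ 2 + Real.cos (u 2) ^ 2) := by rw [hσ, h1]; ring
      _ = β₀ := by rw [Real.sin_sq_add_cos_sq, mul_one]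

omit [T2Space X] [CompactSpace X] [IsManifold (𝓡 4) ∞ X] [Fintype ι] in
/-- The rim map is smooth on `{u₀² + u₁² < a_R}`. [folklore] -/
theorem contMDiffAt_rimMap {σ : ℝ} (hσ : σ ^ 2 = 1) (hβ₀ : 0 ≤ β₀) (hβ₀η : β₀ < η) (haR : aR < η) (j : ι) {u : 𝔼 3}
    (hu : u 0 ^ 2 + u 1 ^ 2 < aR) : ContMDiffAt 𝓘(ℝ, 𝔼 3) (𝓡 4) ∞ (H.rimMap σ β₀ j) u := by
  have hvn := H.norm_rimVec_lt hσ hβ₀ hβ₀η haR j hu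
  have h1 := (H.box j).contMDiffAt_chart_symm_add hvn
  have h2 : ContMDiff 𝓘(ℝ, 𝔼 3) 𝓘(ℝ, 𝔼 4) ∞ fun u : 𝔼 3 =>
      vec4 (u 0) (u 1) (σ * Real.sqrt β₀ * Real.cos (u 2)) (Real.sqrt β₀ * Real.sin (u 2)) := by
    refine ContDiff.contMDiff ?_
    rw [contDiff_piLp]
    intro i
    fin_cases i
    · exact (d3 0 : 𝔼 3 →L[ℝ] ℝ).contDiff
    · exact (d3 1 : 𝔼 3 →L[ℝ] ℝ).contDiff
    · exact contDiff_const.mul (Real.contDiff_cos.comp (d3 2 : 𝔼 3 →L[ℝ] ℝ).contDiff)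
    · exact contDiff_const.mul (Real.contDiff_sin.comp (d3 2 : 𝔼 3 →L[ℝ] ℝ).contDiff)
  have heq : H.rimMap σ β₀ j = (fun w => (H.box j).chart.symm ((H.box j).chart (H.cpt j) + w)) ∘ fun u : 𝔼 3 =>
      vec4 (u 0) (u 1) (σ * Real.sqrt β₀ * Real.cos (u 2)) (Real.sqrt β₀ * Real.sin (u 2)) := rfl
  rw [heq]
  exact h1.comp u h2.contMDiffAt

omit [T2Space X] [CompactSpace X] [IsManifold (𝓡 4) ∞ X] [Fintype ι] in
/-- The rim coordinates are smooth at points of `source_j` with `|y₃| < √β₀`. [folklore] -/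
theorem contMDiffAt_rimCoord (hβ₀ : 0 < β₀) {j : ι} {z : X} (hz : z ∈ (H.box j).chart.source)
    (hy : |(H.box j).coord z 3| < Real.sqrt β₀) : ContMDiffAt (𝓡 4) 𝓘(ℝ, 𝔼 3) ∞ (H.rimCoord β₀ j) z := by
  have hc : ContMDiffAt (𝓡 4) 𝓘(ℝ, 𝔼 4) ∞ (H.box j).coord z :=
    ((H.box j).chart.contMDiffAt_extend (H.box j).mem_maximalAtlas hz).sub contMDiffAt_const
  have hci : ∀ i : Fin 4, ContMDiffAt (𝓡 4) 𝓘(ℝ, ℝ) ∞ (fun w => (H.box j).coord w i) z := fun i =>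
    ((EuclideanSpace.proj i : 𝔼 4 →L[ℝ] ℝ).contDiff.contMDiff.contMDiffAt).comp z hc
  have hsq : 0 < Real.sqrt β₀ := Real.sqrt_pos.2 hβ₀
  have ht : |(H.box j).coord z 3 / Real.sqrt β₀| < 1 := by
    rw [abs_div, abs_of_pos hsq, div_lt_one hsq]; exact hy
  have h1 : ContDiffAt ℝ ∞ Real.arcsin ((H.box j).coord z 3 / Real.sqrt β₀) :=
    Real.contDiffAt_arcsin (by intro h0; rw [h0] at ht; norm_num at ht) (by intro h0; rw [h0] at ht; norm_num at ht)
  have h2 : ContMDiffAt (𝓡 4) 𝓘(ℝ, ℝ) ∞ (fun w => (H.box j).coord w 3 / Real.sqrt β₀) z := (hci 3).div_const _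
  have harc : ContMDiffAt (𝓡 4) 𝓘(ℝ, ℝ) ∞ (Real.arcsin ∘ fun w => (H.box j).coord w 3 / Real.sqrt β₀) z :=
    h1.contMDiffAt.comp z h2
  have heq : H.rimCoord β₀ j = fun w => (H.box j).coord w 0 • E3 0 + (H.box j).coord w 1 • E3 1 +
      Real.arcsin ((H.box j).coord w 3 / Real.sqrt β₀) • E3 2 := by
    funext w; rw [rimCoord, vec3_eq_sum]
  rw [heq]
  exact (((hci 0).smul contMDiffAt_const).add ((hci 1).smul contMDiffAt_const)).add (harc.smul contMDiffAt_const)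

omit [T2Space X] [CompactSpace X] [IsManifold (𝓡 4) ∞ X] [Fintype ι] in
/-- `|sin t| < 1` for `|t| < π/2`. [folklore] -/
theorem abs_sin_lt_one_of_abs_lt {t : ℝ} (ht : |t| < Real.pi / 2) : |Real.sin t| < 1 := by
  have hc : 0 < Real.cos t := Real.cos_pos_of_mem_Ioo ⟨by linarith [(abs_lt.1 ht).1], (abs_lt.1 ht).2⟩
  have h1 : Real.sin t ^ 2 < 1 := by nlinarith [Real.sin_sq_add_cos_sq t]
  exact (sq_lt_one_iff_abs_lt_one _).1 h1

omit [T2Space X] [CompactSpace X] [IsManifold (𝓡 4) ∞ X] [Fintype ι] in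
/-- The set `V` of the rim parametrisation is open. [folklore] -/
theorem isOpen_rimV (σ : ℝ) (j : ι) :
    IsOpen {z : X | z ∈ (H.box j).chart.source ∧ H.A j z < aR ∧ 0 < σ * (H.box j).coord z 2 ∧
      |(H.box j).coord z 3| < Real.sqrt β₀} := by
  rw [isOpen_iff_mem_nhds]
  rintro z ⟨hz, hA, h2, h3⟩
  have hcA : ContinuousAt (H.A j) z := (H.continuousOn_A j).continuousAt ((H.box j).chart.open_source.mem_nhds hz)
  have hc : ContinuousAt (H.box j).coord z :=
    (((H.box j).chart.contMDiffAt_extend (H.box j).mem_maximalAtlas hz).sub contMDiffAt_const).continuousAt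
  have hci : ∀ i : Fin 4, ContinuousAt (fun w => (H.box j).coord w i) z := fun i =>
    ((EuclideanSpace.proj i : 𝔼 4 →L[ℝ] ℝ).continuous.continuousAt).comp hc
  filter_upwards [(H.box j).chart.open_source.mem_nhds hz, hcA.eventually (Iio_mem_nhds hA),
    ((hci 2).const_mul σ |>.eventually (Ioi_mem_nhds h2) : ∀ᶠ w in 𝓝 z, 0 < σ * (H.box j).coord w 2),
    ((continuous_abs.continuousAt.comp (hci 3)).eventually (Iio_mem_nhds h3) : ∀ᶠ w in 𝓝 z, |(H.box j).coord w 3| < Real.sqrt β₀)]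
    with w hw hwA hw2 hw3
  exact ⟨hw, hwA, hw2, hw3⟩

/-- The plateau in the form used on the zone. [folklore] -/
theorem plateau_zone (hplateau : ∀ s, -η / 2 < s → s ≤ Sbot → χlo s = 1 ∧ χhi s = 1) (hSbot₁ : η + β₀ ≤ Sbot) :
    ∀ s, -η / 2 < s → s ≤ η + β₀ → χlo s = 1 ∧ χhi s = 1 :=
  fun s h1 h2 => hplateau s h1 (h2.trans hSbot₁)

/-- **On the zone part of `N`, `B_j = β₀`** (the affine-range hypothesis discharged from the
range of the top height). [cite: GayKirby2016, §4, Lemma 14] -/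
theorem B_eq_of_mem_zone (hgl : IsGradientLike (𝓡 4) f ξ) (hfM : IsMorse (𝓡 4) f)
    {v₁ : ℝ} (hPsw : 2 * Psw ≤ η ^ 2) (hP₁ : 2 * P₁ < Psw)
    (hTP₂ : ∀ P, 2 * P₁ ≤ P → TP P = Spl) (hh₂v : ∀ t ≤ v₁, h₂ t = Spl)
    (hφv : ∀ j (y : RegularLevel h), y.1 ∈ (H.box j).chart.source → H.P j y.1 < 2 * Psw → φ y ≤ v₁)
    (hTP₁ : ∀ P, P ≤ P₁ → TP P = η + β₀ - P / β₀) (hβ₀ : 0 < β₀)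
    (hplateau : ∀ s, -η / 2 < s → s ≤ Sbot → χlo s = 1 ∧ χhi s = 1) (hSbot₂ : Sbot < 2 * η)
    (hTmem : ∀ z, H.topHeightBot hξ h φ h₂ TP χlo χhi Spl Sbot Smin Psw z ∈ Icc (-Smin) Sbot) (hSmin : Smin < η / 2)
    (hP₁rim : aR * (Sbot - η + aR) ≤ P₁)
    {j : ι} {z : X} (hz : z ∈ (H.box j).chart.source) (hA : H.A j z < aR)
    (hγ : H.gapFn hξ h φ h₂ TP χlo χhi Spl Sbot Smin Psw z = 0) : H.B j z = β₀ := by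
  have hη := H.eta_pos
  obtain ⟨hl, hu⟩ := hTmem z
  have hs : f z - a = H.topHeightBot hξ h φ h₂ TP χlo χhi Spl Sbot Smin Psw z := by rw [gapFn_apply] at hγ; linarith
  have hf₁ : a - η < f z := by linarith
  have hf₂ : f z < a + 2 * η := by linarith
  have hA0 := H.A_nonneg j z
  have hBle : H.B j z ≤ Sbot - η + aR := by have := H.apply_eq hz; linarith
  have hPz : H.P j z ≤ P₁ := by
    rw [P_def]
    have : H.A j z * H.B j z ≤ aR * (Sbot - η + aR) :=
      mul_le_mul hA.le hBle (H.B_nonneg j z) (by linarith)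
    linarith
  obtain ⟨hlo, hhi⟩ := hplateau (f z - a) (by linarith) (by linarith)
  exact (H.B_eq_of_gapFn_eq_zero hgl hfM hPsw hP₁ hTP₂ hh₂v hφv hTP₁ hβ₀ hz hPz hf₁ hf₂ hlo hhi hγ).1

section Rim

variable (hgl : IsGradientLike (𝓡 4) f ξ) (hfM : IsMorse (𝓡 4) f)
  {v₁ : ℝ} (hPsw : 2 * Psw ≤ η ^ 2) (hP₁ : 2 * P₁ < Psw)
  (hTP₂ : ∀ P, 2 * P₁ ≤ P → TP P = Spl) (hh₂v : ∀ t ≤ v₁, h₂ t = Spl)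
  (hφv : ∀ j (y : RegularLevel h), y.1 ∈ (H.box j).chart.source → H.P j y.1 < 2 * Psw → φ y ≤ v₁)
  (hTP₁ : ∀ P, P ≤ P₁ → TP P = η + β₀ - P / β₀) (hβ₀ : 0 < β₀) (hβ₀η : β₀ < η)
  (haRP : aR * β₀ ≤ P₁) (haR : aR < η)
  (hplateau : ∀ s, -η / 2 < s → s ≤ Sbot → χlo s = 1 ∧ χhi s = 1) (hSbot₁ : η + β₀ ≤ Sbot) (hSbot₂ : Sbot < 2 * η)
  (hTmem : ∀ z, H.topHeightBot hξ h φ h₂ TP χlo χhi Spl Sbot Smin Psw z ∈ Icc (-Smin) Sbot) (hSmin : Smin < η / 2)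
  (hP₁rim : aR * (Sbot - η + aR) ≤ P₁)
include hgl hfM hPsw hP₁ hTP₂ hh₂v hφv hTP₁ hβ₀ hβ₀η haRP haR hplateau hSbot₁ hSbot₂ hTmem hSmin hP₁rim

/-- **The rim parametrisation data of `N`** at the rim point `(0, 0, σ√β₀, 0)` of `box_j`
(`σ = ±1`). [cite: GayKirby2016, §4, Lemma 14] [cite: HirschDT1976, Ch. 1 §3, Thm. 3.2] -/
def rimParam {σ : ℝ} (hσ : σ = 1 ∨ σ = -1)
    (hγ : IsRegularLevel (𝓡 4) (H.gapFn hξ h φ h₂ TP χlo χhi Spl Sbot Smin Psw) 0) (j : ι) : hγ.Param where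
  O := {u : 𝔼 3 | u 0 ^ 2 + u 1 ^ 2 < aR ∧ |u 2| < Real.pi / 2}
  isOpen_O := by
    have h1 : Continuous fun u : 𝔼 3 => u 0 ^ 2 + u 1 ^ 2 :=
      (((d3 0 : 𝔼 3 →L[ℝ] ℝ).continuous).pow 2).add (((d3 1 : 𝔼 3 →L[ℝ] ℝ).continuous).pow 2)
    have h2 : Continuous fun u : 𝔼 3 => |u 2| := continuous_abs.comp (d3 2 : 𝔼 3 →L[ℝ] ℝ).continuous
    exact (isOpen_lt h1 continuous_const).inter (isOpen_lt h2 continuous_const)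
  ψ := H.rimMap σ β₀ j
  contMDiffOn_ψ u hu :=
    (H.contMDiffAt_rimMap (by rcases hσ with h | h <;> simp [h]) hβ₀.le hβ₀η haR j hu.1).contMDiffWithinAt
  apply_ψ u hu := by
    have hσ2 : σ ^ 2 = 1 := by rcases hσ with h | h <;> simp [h]
    obtain ⟨hsrc, -, hA, hB⟩ := H.rimMap_props hσ2 hβ₀.le hβ₀η haR j hu.1
    exact (H.gapFn_eq_zero_of_B_eq (ρ := fun t => t) (χb := fun t => t) (c₀ := 0) (ε := 0) (κ := 0)
      hgl hfM hPsw hP₁ hTP₂ hh₂v hφv hTP₁ hβ₀ hβ₀η haRP haR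
      (plateau_zone hplateau hSbot₁)
      hsrc (by rw [hA]; exact hu.1) hB).1
  V := {z : X | z ∈ (H.box j).chart.source ∧ H.A j z < aR ∧ 0 < σ * (H.box j).coord z 2 ∧
      |(H.box j).coord z 3| < Real.sqrt β₀}
  isOpen_V := H.isOpen_rimV σ j
  ψ_mem u hu := by
    have hσ2 : σ ^ 2 = 1 := by rcases hσ with h | h <;> simp [h]
    obtain ⟨hsrc, hcoord, hA, -⟩ := H.rimMap_props hσ2 hβ₀.le hβ₀η haR j hu.1
    have hsq : 0 < Real.sqrt β₀ := Real.sqrt_pos.2 hβ₀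
    have hcos : 0 < Real.cos (u 2) := Real.cos_pos_of_mem_Ioo ⟨by linarith [(abs_lt.1 hu.2).1], (abs_lt.1 hu.2).2⟩
    refine ⟨hsrc, by rw [hA]; exact hu.1, ?_, ?_⟩
    · rw [hcoord]; simp only [vec4_apply_two]
      have : σ * (σ * Real.sqrt β₀ * Real.cos (u 2)) = σ ^ 2 * (Real.sqrt β₀ * Real.cos (u 2)) := by ring
      rw [this, hσ2, one_mul]; positivity
    · rw [hcoord]; simp only [vec4_apply_three]
      rw [abs_mul, abs_of_pos hsq]
      have := abs_sin_lt_one_of_abs_lt hu.2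
      nlinarith
  lam := H.rimCoord β₀ j
  contMDiffOn_lam z hz := (H.contMDiffAt_rimCoord hβ₀ hz.1 hz.2.2.2).contMDiffWithinAt
  lam_ψ u hu := by
    have hσ2 : σ ^ 2 = 1 := by rcases hσ with h | h <;> simp [h]
    obtain ⟨-, hcoord, -, -⟩ := H.rimMap_props hσ2 hβ₀.le hβ₀η haR j hu.1
    have hsq : Real.sqrt β₀ ≠ 0 := (Real.sqrt_pos.2 hβ₀).ne'
    show H.rimCoord β₀ j (H.rimMap σ β₀ j u) = u
    rw [rimCoord, hcoord]
    simp only [vec4_apply_zero, vec4_apply_one, vec4_apply_three]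
    rw [mul_div_cancel_left₀ _ hsq, Real.arcsin_sin (by linarith [(abs_lt.1 hu.2).1]) (abs_lt.1 hu.2).2.le, vec3_eta]
  ψ_lam z hz hz0 := by
    obtain ⟨hzs, hzA, hz2, hz3⟩ := hz
    have hsq : 0 < Real.sqrt β₀ := Real.sqrt_pos.2 hβ₀
    have hB : H.B j z = β₀ :=
      H.B_eq_of_mem_zone hgl hfM hPsw hP₁ hTP₂ hh₂v hφv hTP₁ hβ₀ hplateau hSbot₂ hTmem hSmin hP₁rim hzs hzA hz0
    set t := (H.box j).coord z 3 / Real.sqrt β₀ with ht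
    have ht1 : |t| < 1 := by rw [ht, abs_div, abs_of_pos hsq, div_lt_one hsq]; exact hz3
    have htm : -1 ≤ t := by linarith [(abs_lt.1 ht1).1]
    have htM : t ≤ 1 := (abs_lt.1 ht1).2.le
    refine ⟨⟨by show (H.box j).coord z 0 ^ 2 + (H.box j).coord z 1 ^ 2 < aR; rw [← A_eq_coord]; exact hzA, ?_⟩, ?_⟩
    · show |Real.arcsin t| < Real.pi / 2
      rw [abs_lt]
      exact ⟨Real.neg_pi_div_two_lt_arcsin.2 (by linarith [(abs_lt.1 ht1).1]), Real.arcsin_lt_pi_div_two.2 (abs_lt.1 ht1).2⟩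
    · -- the coordinates of `rimMap (rimCoord z)` are those of `z`
      show H.rimMap σ β₀ j (H.rimCoord β₀ j z) = z
      have hy2 : σ * Real.sqrt β₀ * Real.cos (Real.arcsin t) = (H.box j).coord z 2 := by
        rw [Real.cos_arcsin]
        have h1 : Real.sqrt β₀ * Real.sqrt (1 - t ^ 2) = |(H.box j).coord z 2| := by
          rw [← Real.sqrt_mul hβ₀.le, ← Real.sqrt_sq_eq_abs]
          congr 1
          have hBc := H.B_eq_coord j z
          rw [hB] at hBc
          rw [ht, div_pow, Real.sq_sqrt hβ₀.le]
          field_simp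
          linarith
        rw [mul_assoc, h1]
        rcases hσ with h | h
        · subst h; rw [one_mul, abs_of_pos (by simpa using hz2)]
        · subst h
          have : (H.box j).coord z 2 < 0 := by linarith
          rw [abs_of_neg this]; ring
      have hy3 : Real.sqrt β₀ * Real.sin (Real.arcsin t) = (H.box j).coord z 3 := by
        rw [Real.sin_arcsin htm htM, ht, mul_div_cancel₀ _ hsq.ne']
      rw [rimMap, rimCoord]
      simp only [vec3_apply_zero, vec3_apply_one, vec3_apply_two]
      rw [hy2, hy3, vec4_eta, MilnorBox.coord_eq, add_sub_cancel, (H.box j).chart.left_inv hzs]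

/-- `0` lies in the parameter domain. [folklore] -/
theorem zero_mem_rimO {σ : ℝ} (hσ : σ = 1 ∨ σ = -1)
    (hγ : IsRegularLevel (𝓡 4) (H.gapFn hξ h φ h₂ TP χlo χhi Spl Sbot Smin Psw) 0) (j : ι) (haR0 : 0 < aR) :
    (0 : 𝔼 3) ∈ (H.rimParam hgl hfM hPsw hP₁ hTP₂ hh₂v hφv hTP₁ hβ₀ hβ₀η haRP haR hplateau hSbot₁ hSbot₂ hTmem hSmin hP₁rim hσ hγ j).O := by
  change (0 : 𝔼 3) 0 ^ 2 + (0 : 𝔼 3) 1 ^ 2 < aR ∧ |(0 : 𝔼 3) 2| < Real.pi / 2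
  exact ⟨by simpa using haR0, by simpa using Real.pi_div_two_pos⟩

/-- The parametrisation of the rim data is the rim map. [folklore] -/
theorem rimParam_ψ {σ : ℝ} (hσ : σ = 1 ∨ σ = -1)
    (hγ : IsRegularLevel (𝓡 4) (H.gapFn hξ h φ h₂ TP χlo χhi Spl Sbot Smin Psw) 0) (j : ι) :
    (H.rimParam hgl hfM hPsw hP₁ hTP₂ hh₂v hφv hTP₁ hβ₀ hβ₀η haRP haR hplateau hSbot₁ hSbot₂ hTmem hSmin hP₁rim hσ hγ j).ψ =
      H.rimMap σ β₀ j := rfl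

/-- **Morse data of the top-face function at the rim points.**  With `ρ ≡ ρ₀`, `χ_b ≡ χ₀` on
`[0, a₀]`, `κβ₀/η > ερ₀`, `c₀, ε₄, χ₀ > 0`: the rim point `(0, 0, σ√β₀, 0)` is a nondegenerate
critical point of `Φ_N`, of index `1` for `σ = 1` and `0` for `σ = -1`.
[cite: GayKirby2016, §4, Lemma 14] [cite: Milnor1963, §2] -/
theorem morseData_phiN_rim {σ : ℝ} (hσ : σ = 1 ∨ σ = -1)
    (hγ : IsRegularLevel (𝓡 4) (H.gapFn hξ h φ h₂ TP χlo χhi Spl Sbot Smin Psw) 0) (j : ι) (haR0 : 0 < aR)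
    [Nonempty (RegularLevel hγ)]
    {a₀ : ℝ} (ha₀ : 0 < a₀) (hρ0 : ∀ A, A < a₀ → ρ A = ρ 0) (hχ0 : ∀ A, A < a₀ → χb A = χb 0)
    (hc₀ : 0 < c₀) (hε₄ : 0 < ε₄) (hχpos : 0 < χb 0) (hdesign : ε * ρ 0 < κ * β₀ / η) (hκ : 0 < κ)
    (hρs : ContDiff ℝ ∞ ρ) (hχs : ContDiff ℝ ∞ χb) :
    IsMCriticalPt (𝓡 3) (H.phiN hξ h φ ρ χb c₀ ε κ aR ε₄ ∘ RegularLevel.incl hγ)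
        ((H.rimParam hgl hfM hPsw hP₁ hTP₂ hh₂v hφv hTP₁ hβ₀ hβ₀η haRP haR hplateau hSbot₁ hSbot₂ hTmem hSmin hP₁rim hσ hγ j).lift 0) ∧
      (mhessian (𝓡 3) (H.phiN hξ h φ ρ χb c₀ ε κ aR ε₄ ∘ RegularLevel.incl hγ)
        ((H.rimParam hgl hfM hPsw hP₁ hTP₂ hh₂v hφv hTP₁ hβ₀ hβ₀η haRP haR hplateau hSbot₁ hSbot₂ hTmem hSmin hP₁rim hσ hγ j).lift 0)).Nondegenerate ∧
      morseIndex (𝓡 3) (H.phiN hξ h φ ρ χb c₀ ε κ aR ε₄ ∘ RegularLevel.incl hγ)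
        ((H.rimParam hgl hfM hPsw hP₁ hTP₂ hh₂v hφv hTP₁ hβ₀ hβ₀η haRP haR hplateau hSbot₁ hSbot₂ hTmem hSmin hP₁rim hσ hγ j).lift 0) =
        (if σ = 1 then 1 else 0) ∧
      RegularLevel.incl hγ
        ((H.rimParam hgl hfM hPsw hP₁ hTP₂ hh₂v hφv hTP₁ hβ₀ hβ₀η haRP haR hplateau hSbot₁ hSbot₂ hTmem hSmin hP₁rim hσ hγ j).lift 0) =
        H.rimMap σ β₀ j 0 := by
  set P := H.rimParam hgl hfM hPsw hP₁ hTP₂ hh₂v hφv hTP₁ hβ₀ hβ₀η haRP haR hplateau hSbot₁ hSbot₂ hTmem hSmin hP₁rim hσ hγ j with hPdef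
  have hψ : P.ψ = H.rimMap σ β₀ j := by rw [hPdef]; rfl
  have hη := H.eta_pos
  have hσ2 : σ ^ 2 = 1 := by rcases hσ with h | h <;> simp [h]
  have h0O : (0 : 𝔼 3) ∈ P.O := H.zero_mem_rimO hgl hfM hPsw hP₁ hTP₂ hh₂v hφv hTP₁ hβ₀ hβ₀η haRP haR hplateau hSbot₁ hSbot₂
    hTmem hSmin hP₁rim hσ hγ j haR0
  have hincl : RegularLevel.incl hγ (P.lift 0) = H.rimMap σ β₀ j 0 := by rw [P.incl_lift h0O, hψ]
  -- the model function and the eventual equality near `0`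
  set K := ε₄ * χb 0 * σ * Real.sqrt β₀ with hK
  set Φ := H.phiN hξ h φ ρ χb c₀ ε κ aR ε₄ ∘ RegularLevel.incl hγ with hΦ
  have hsmallA : ∀ᶠ u in 𝓝 (0 : 𝔼 3), u 0 ^ 2 + u 1 ^ 2 < min aR a₀ := by
    have h1 : Continuous fun u : 𝔼 3 => u 0 ^ 2 + u 1 ^ 2 :=
      (((d3 0 : 𝔼 3 →L[ℝ] ℝ).continuous).pow 2).add (((d3 1 : 𝔼 3 →L[ℝ] ℝ).continuous).pow 2)
    have : (fun u : 𝔼 3 => u 0 ^ 2 + u 1 ^ 2) 0 < min aR a₀ := by simp [haR0, ha₀]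
    exact h1.continuousAt.eventually (Iio_mem_nhds this)
  have hev : (Φ ∘ P.lift) =ᶠ[𝓝 0] fun u => quadCos c₀ (c₀ * (κ * β₀ / η - ε * ρ 0)) (c₀ * (κ * β₀ / η)) K u + 0 := by
    filter_upwards [hsmallA, P.isOpen_O.mem_nhds h0O] with u hu huO
    have huA : u 0 ^ 2 + u 1 ^ 2 < aR := lt_of_lt_of_le hu (min_le_left _ _)
    have hua : u 0 ^ 2 + u 1 ^ 2 < a₀ := lt_of_lt_of_le hu (min_le_right _ _)
    obtain ⟨hsrc, hcoord, hA, hB⟩ := H.rimMap_props hσ2 hβ₀.le hβ₀η haR j huA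
    obtain ⟨-, -, hθ, hβ⟩ := H.gapFn_eq_zero_of_B_eq (ρ := ρ) (χb := χb) (c₀ := c₀) (ε := ε) (κ := κ) (Sbot := Sbot)
      (Smin := Smin) hgl hfM hPsw hP₁ hTP₂ hh₂v hφv hTP₁ hβ₀ hβ₀η haRP haR
      (plateau_zone hplateau hSbot₁)
      hsrc (by rw [hA]; exact huA) hB
    show H.phiN hξ h φ ρ χb c₀ ε κ aR ε₄ (RegularLevel.incl hγ (P.lift u)) = _ + 0
    rw [P.incl_lift huO, hψ, add_zero]
    have hnsq : TubeModel.nsq (RadialThickening.proj ((H.box j).coord (H.rimMap σ β₀ j u))) = u 0 ^ 2 + u 1 ^ 2 := by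
      rw [← A_eq_nsq, hA]
    have hbsq : RadialThickening.bsq ((H.box j).coord (H.rimMap σ β₀ j u)) = β₀ := by rw [← B_eq_bsq, hB]
    rw [HandleBoxes.phiN, hθ, hβ, TubeModel.tubeHat_apply, ChartZone.gmod_apply, hnsq, hbsq, RadialThickening.proj_apply_zero,
      hA, hcoord, hρ0 _ hua, hχ0 _ hua]
    simp only [vec4_apply_zero, vec4_apply_two, quadCos, hK]
    ring
  -- Morse data of the model
  have hKne : K ≠ 0 := by
    rw [hK]; rcases hσ with h | h <;> subst h <;> positivity
  have ha' : 0 < c₀ * (κ * β₀ / η - ε * ρ 0) := mul_pos hc₀ (by linarith)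
  have hb' : 0 < c₀ * (κ * β₀ / η) := mul_pos hc₀ (by positivity)
  obtain ⟨hcritQ, hndQ, hidxQ⟩ := morseData_quadCos (C := c₀) ha' hb' hKne
  -- transfer to `Φ ∘ lift`
  have hcritL : IsMCriticalPt (𝓡 3) (Φ ∘ P.lift) 0 := (isMCriticalPt_congr_of_eventuallyEq_add_const (I := 𝓡 3) hev).2 hcritQ
  have hhessL := mhessian_congr_of_eventuallyEq_add_const (I := 𝓡 3) hev
  have hidxL := morseIndex_congr_of_eventuallyEq_add_const (I := 𝓡 3) hev
  -- smoothness of `Φ` at the point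
  have hprops := H.rimMap_props hσ2 hβ₀.le hβ₀η haR j (u := 0) (by simpa using haR0)
  have hzone : H.rimMap σ β₀ j 0 ∈ H.zone aR j := ⟨hprops.1, by rw [hprops.2.2.1]; simpa using haR0⟩
  have hΦ2 : ContMDiffAt (𝓡 3) 𝓘(ℝ, ℝ) 2 Φ (P.lift 0) := by
    have hX : ContMDiffAt (𝓡 4) 𝓘(ℝ, ℝ) ∞ (H.phiN hξ h φ ρ χb c₀ ε κ aR ε₄) (RegularLevel.incl hγ (P.lift 0)) := by
      rw [hincl]
      exact H.contMDiffAt_phiN_zone (hξ := hξ) (h := h) (φ := φ) (c₀ := c₀) (ε := ε) (κ := κ) (ε₄ := ε₄) hρs hχs hzone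
    exact ((hX.comp (P.lift 0) (RegularLevel.contMDiff_incl hγ (P.lift 0))).of_le (by norm_cast))
  -- criticality of `Φ`
  have hcritP : IsMCriticalPt (𝓡 3) Φ (P.lift 0) := by
    rw [P.isMCriticalPt_iff h0O (hΦ2.mdifferentiableAt (by norm_cast))]
    exact (MorseBirth.isMCriticalPt_iff_fderiv _ _).1 hcritL
  obtain ⟨hndP, hidxP⟩ := P.morseData h0O hΦ2 hcritP
  refine ⟨hcritP, ?_, ?_, hincl⟩
  · rw [hndP, hhessL]; exact hndQ
  · rw [hidxP, hidxL, hidxQ]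
    rcases hσ with h1 | h1
    · subst h1
      have hKpos : 0 < K := by rw [hK]; positivity
      rw [if_pos hKpos, if_pos rfl]
    · subst h1
      have hKneg : ¬ (0 < K) := by
        rw [hK]; push Not
        have : 0 < ε₄ * χb 0 * Real.sqrt β₀ := by positivity
        nlinarith
      rw [if_neg hKneg, if_neg (by norm_num)]

end Rim

end HandleBoxes

end Literature.Topology.FourManifolds

end
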